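import Summits.BirchSwinnertonDyer.BirchSwinnertonDyer.Theorems.CumulativeHeegnerLeopoldtCumulativeHeegnerInclusionAtThreeUnrSeriesDomination
import HarnessLib

/-!
# Crux K1 `CumulativeHeegnerInclusionAtThree` (stmt-BirchSwinnertonDyer-24198), line `birth`: the SHARP
# values currency of K1's own conclusion `span{L} ≤ (g)` (no power of `3`) — `g ∣ L` in `Λ^ur = R₀⟦T⟧`
# iff `‖L(x)‖ ≤ ‖g(x)‖` at (all but finitely many) points of the open unit disc of `ℂ_p`

Width seat bsd-line-chl-k1-p1-w2 (`--supports stmt-BirchSwinnertonDyer-24198`), Λ^ur-adapter lane. The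
companion `…UnrSeriesDomination` proves: domination with SOME constant, `‖L(x)‖ ≤ C · ‖g(x)‖`, is
equivalent to `∃ μ, p^μ · L ∈ (g)` — the currency of stub A (crux 26896). The crux K1 itself concludes the
`μ`-free `span{L} ≤ (Ch_Λ X).map toUnr`; on the route it is reached from A via K2 (`μ = 0`, equal `λ`) and
stub C (`3`-saturation). Here is the direct values form of the `μ`-FREE divisibility:

* §1 `norm_eval_prod_X_sub_C_eq_pow`: if every root `α` of a split monic polynomial has `‖α‖ < ‖x‖` then
  `‖P(x)‖ = ‖x‖^{deg P}` (ultrametric: `‖x − α‖ = ‖x‖`).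
* §2 `exists_point_near_rim`: for finitely many points `α_i` of the open disc, a finite set `F` and
  `d : ℕ`, there is `x ∉ F` in the disc with all `‖α_i‖ < ‖x‖` and `p⁻¹ < ‖x‖^d` (a root `z` of
  `z^m = p` for `m` large — `ℂ_p` is algebraically closed and its value group accumulates at `1` —,
  moved off `F` along the units `1 + p^{k+1}`).
* §3 **`mem_span_of_norm_value_le`**: for `g ≠ 0`, `L` in `R₀⟦T⟧`, if `‖L(x)‖ ≤ ‖g(x)‖` at every point
  of the open unit disc outside a finite set, then `L ∈ (g)`. Proof: by the companion, `p^μ L = q g`;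
  write `q = p^b q₀`, `q₀ = P_q U_q` (content + Weierstrass); if `b ≥ μ` cancel `p^μ`; if `b < μ`,
  evaluate at a point of §2 beyond all roots of `P_q` and of the distinguished part of `g`:
  `‖L(x)‖ = p^{μ−b} ‖x‖^{deg P_q} ‖g(x)‖ > ‖g(x)‖ > 0`, contradiction. With the converse
  (`norm_value_le_of_mem_span`, `‖q(x)‖ ≤ 1`): **`mem_span_iff_norm_value_le`** — `L ∈ (g)` iff
  `‖L(x)‖ ≤ ‖g(x)‖` on the whole open disc. This is K1's conclusion in values currency (take `g` a
  generator of `(Ch_Λ X_{∅,0}).map toUnr`): the constant in a Kolyvagin-system bound must be EXACTLY `1`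
  at (almost) every specialisation for K1, versus any uniform constant for A.
* §4 `span_eq_span_iff_norm_value_eq` / `associated_iff_norm_value_eq`: `(L) = (g)` ⟺ `‖L(x)‖ = ‖g(x)‖`
  on the disc — the values currency of the main-conjecture EQUALITY.

HONEST FRAMING: pure `p`-adic algebra on the receptacle; nothing about elliptic curves, Selmer groups
or `L`-functions is constructed or asserted; closes nothing by itself. No definition, no named fact, no
`sorry`. BSD is not proved by any of this; no summit statement is proved by this seat.

References: [Washington1997] §7.1 Prop. 7.2, Thm. 7.3; [Lang1990] Ch. 5 §2 (Gauss norm and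
divisibility in `𝔬⟦T⟧`); route-BirchSwinnertonDyer-CumulativeHeegnerLeopoldt (K1 vs A: the `μ`-part).
-/

set_option autoImplicit false
-- `…BirchSwinnertonDyer.BirchSwinnertonDyer.Theorems…` is the problem's mandated namespace (D-0017).
set_option linter.dupNamespace false

noncomputable section

open scoped Classical

open Filter Topology PowerSeries Literature.NumberTheory.EllipticCurves
  Summit.BirchSwinnertonDyer.Rank1Residual.X11b.Halves
  Summit.BirchSwinnertonDyer.Rank1Residual.X2.HidaLimitAlgebra
  Summit.BirchSwinnertonDyer.BirchSwinnertonDyer.Theorems.CongruentShaFreeCutUnrSeriesWeierstrass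
  Summit.BirchSwinnertonDyer.BirchSwinnertonDyer.Theorems.CumulativeHeegnerInclusionAtThreeUnrSeriesZeros
  Summit.BirchSwinnertonDyer.BirchSwinnertonDyer.Theorems.CumulativeHeegnerInclusionAtThreeUnrSeriesDomination

open Summit.BirchSwinnertonDyer.BirchSwinnertonDyer.Theorems.CongruentShaFreeCutPadicSupplyRate
  (norm_value_le_one)

namespace Summit.BirchSwinnertonDyer.BirchSwinnertonDyer.Theorems.CumulativeHeegnerInclusionAtThreeUnrSeriesDominationSharp

variable {p : ℕ} [hp : Fact p.Prime]

/-! ### §1 Beyond its roots a monic polynomial has `‖P(x)‖ = ‖x‖^{deg P}` -/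

/-- `‖∏ (x − α_i)‖ = ‖x‖^d` when every `‖α_i‖ < ‖x‖` (ultrametric: `‖x − α_i‖ = ‖x‖`). [folklore] -/
theorem norm_eval_prod_X_sub_C_eq_pow (s : Multiset ℂ_[p]) {x : ℂ_[p]} (hs : ∀ a ∈ s, ‖a‖ < ‖x‖) :
    ‖((s.map fun a ↦ Polynomial.X - Polynomial.C a).prod).eval x‖ = ‖x‖ ^ Multiset.card s := by
  induction s using Multiset.induction_on with
  | empty => simp
  | cons a s ih =>
    have ha : ‖a‖ < ‖x‖ := hs a (Multiset.mem_cons_self a s)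
    have hs' : ∀ b ∈ s, ‖b‖ < ‖x‖ := fun b hb ↦ hs b (Multiset.mem_cons_of_mem hb)
    have hxa : ‖x - a‖ = ‖x‖ := by
      rw [sub_eq_add_neg, IsUltrametricDist.norm_add_eq_max_of_norm_ne_norm, max_eq_left]
      · rw [norm_neg]; exact ha.le
      · rw [norm_neg]; exact ha.ne'
    rw [Multiset.map_cons, Multiset.prod_cons, Polynomial.eval_mul, norm_mul, Polynomial.eval_sub,
      Polynomial.eval_X, Polynomial.eval_C, hxa, ih hs', Multiset.card_cons, pow_succ, mul_comm]

/-- For a monic `P ∈ ℂ_p[T]` all of whose roots have norm `< ‖x‖`: `‖P(x)‖ = ‖x‖^{deg P}` (`P` splits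
over the algebraically closed `ℂ_p`). [folklore] -/
theorem norm_eval_eq_pow_natDegree {P : Polynomial ℂ_[p]} (hmo : P.Monic) {x : ℂ_[p]}
    (hroots : ∀ α ∈ P.roots, ‖α‖ < ‖x‖) : ‖P.eval x‖ = ‖x‖ ^ P.natDegree := by
  have hcard : Multiset.card P.roots = P.natDegree := (IsAlgClosed.splits P).natDegree_eq_card_roots.symm
  have hprod : (P.roots.map fun a ↦ Polynomial.X - Polynomial.C a).prod = P :=
    Polynomial.prod_multiset_X_sub_C_of_monic_of_roots_card_eq hmo hcard
  rw [← hcard, ← norm_eval_prod_X_sub_C_eq_pow P.roots hroots, hprod]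

/-! ### §2 Points of the open disc near the rim, beyond given points and off a finite set -/

/-- Moving a point off a finite set without changing its norm: for `z ≠ 0` and `F` finite there is `k`
with `z · (1 + p^{k+1}) ∉ F` (the map `k ↦ z(1 + p^{k+1})` is injective), and `‖z (1 + p^{k+1})‖ = ‖z‖`.
[folklore] -/
theorem exists_mul_one_add_pow_not_mem {F : Set ℂ_[p]} (hF : F.Finite) {z : ℂ_[p]} (hz : z ≠ 0) :
    ∃ k : ℕ, z * (1 + (p : ℂ_[p]) ^ (k + 1)) ∉ F ∧ ‖z * (1 + (p : ℂ_[p]) ^ (k + 1))‖ = ‖z‖ := by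
  have hp0 : (p : ℂ_[p]) ≠ 0 := by exact_mod_cast hp.out.ne_zero
  have hplt : ‖(p : ℂ_[p])‖ < 1 := norm_prime_padicComplex_lt_one
  have hnorm : ∀ k : ℕ, ‖(1 : ℂ_[p]) + (p : ℂ_[p]) ^ (k + 1)‖ = 1 := by
    intro k
    have hlt : ‖(p : ℂ_[p]) ^ (k + 1)‖ < ‖(1 : ℂ_[p])‖ := by
      rw [norm_one, norm_pow]; exact pow_lt_one₀ (norm_nonneg _) hplt (by omega)
    rw [IsUltrametricDist.norm_add_eq_max_of_norm_ne_norm hlt.ne', max_eq_left hlt.le, norm_one]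
  set u : ℕ → ℂ_[p] := fun k ↦ z * (1 + (p : ℂ_[p]) ^ (k + 1)) with hu
  have hinj : Function.Injective u := by
    intro m n hmn
    have h1 : (1 : ℂ_[p]) + (p : ℂ_[p]) ^ (m + 1) = 1 + (p : ℂ_[p]) ^ (n + 1) := mul_left_cancel₀ hz hmn
    have h2 : (p : ℂ_[p]) ^ (m + 1) = (p : ℂ_[p]) ^ (n + 1) := add_left_cancel h1
    have h3 : ‖(p : ℂ_[p])‖ ^ (m + 1) = ‖(p : ℂ_[p])‖ ^ (n + 1) := by
      rw [← norm_pow, ← norm_pow, h2]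
    have h4 := pow_right_injective₀ (norm_pos_iff.mpr hp0) hplt.ne h3
    omega
  have hfin : {k : ℕ | u k ∈ F}.Finite := hF.preimage hinj.injOn
  obtain ⟨k, hk⟩ : ∃ k : ℕ, k ∉ {k : ℕ | u k ∈ F} := hfin.exists_notMem
  exact ⟨k, hk, by rw [norm_mul, hnorm k, mul_one]⟩

/-- **A point of the disc near the rim.** Given finitely many points `α ∈ T` of the open unit disc of
`ℂ_p`, a finite set `F` and `d : ℕ`, there is `x ∉ F` with `‖x‖ < 1`, `‖α‖ < ‖x‖` for all `α ∈ T`,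
`0 < ‖x‖` and `p⁻¹ < ‖x‖^d`: take `z` with `z^m = p` (`ℂ_p` algebraically closed) for `m > d` so large
that `(max ‖α‖)^m < p⁻¹`, then move `z` off `F`. [folklore] -/
theorem exists_point_near_rim (T : Finset ℂ_[p]) (hT : ∀ α ∈ T, ‖α‖ < 1) {F : Set ℂ_[p]} (hF : F.Finite)
    (d : ℕ) : ∃ x : ℂ_[p], x ∉ F ∧ ‖x‖ < 1 ∧ 0 < ‖x‖ ∧ (∀ α ∈ T, ‖α‖ < ‖x‖) ∧
      (p : ℝ)⁻¹ < ‖x‖ ^ d := by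
  have hpR : (1 : ℝ) < p := by exact_mod_cast hp.out.one_lt
  have hpinv0 : (0 : ℝ) < (p : ℝ)⁻¹ := by positivity
  have hpinv1 : (p : ℝ)⁻¹ < 1 := inv_lt_one_of_one_lt₀ hpR
  have hnp : ‖(p : ℂ_[p])‖ = (p : ℝ)⁻¹ :=
    Literature.NumberTheory.LFunctions.Dwork.norm_natCast_p_padicComplex
  -- a common bound `ρ < 1`, `ρ ≥ 1/2`, for the norms of the points of `T`
  set B : Finset ℝ := insert (1 / 2 : ℝ) (T.image fun α ↦ ‖α‖) with hB
  have hBne : B.Nonempty := Finset.insert_nonempty _ _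
  set ρ : ℝ := B.sup' hBne id with hρ
  have hρ1 : ρ < 1 := by
    rw [hρ, Finset.sup'_lt_iff]
    intro b hb
    rw [hB, Finset.mem_insert, Finset.mem_image] at hb
    rcases hb with rfl | ⟨α, hα, rfl⟩
    · simp only [id]; norm_num
    · exact hT α hα
  have hρhalf : (1 / 2 : ℝ) ≤ ρ := Finset.le_sup' id (by rw [hB]; exact Finset.mem_insert_self _ _)
  have hρ0 : 0 < ρ := lt_of_lt_of_le (by norm_num) hρhalf
  have hρT : ∀ α ∈ T, ‖α‖ ≤ ρ := fun α hα ↦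
    Finset.le_sup' id (by rw [hB]; exact Finset.mem_insert_of_mem (Finset.mem_image_of_mem _ hα))
  -- `m > d` with `ρ^m < p⁻¹`
  obtain ⟨n, hn⟩ := exists_pow_lt_of_lt_one hpinv0 hρ1
  set m : ℕ := max n (d + 1) with hm
  have hmn : n ≤ m := le_max_left _ _
  have hmd : d < m := lt_of_lt_of_le (Nat.lt_succ_self d) (le_max_right _ _)
  have hm0 : 0 < m := lt_of_le_of_lt (Nat.zero_le d) hmd
  have hρm : ρ ^ m < (p : ℝ)⁻¹ := (pow_le_pow_of_le_one hρ0.le hρ1.le hmn).trans_lt hn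
  -- `z^m = p`
  obtain ⟨z, hz⟩ := IsAlgClosed.exists_pow_nat_eq (p : ℂ_[p]) hm0
  have hzm : ‖z‖ ^ m = (p : ℝ)⁻¹ := by rw [← norm_pow, hz, hnp]
  have hz0 : z ≠ 0 := by
    intro h0
    rw [h0, norm_zero, zero_pow hm0.ne'] at hzm
    exact hpinv0.ne hzm
  have hz1 : ‖z‖ < 1 := by
    by_contra hge
    rw [not_lt] at hge
    have : (1 : ℝ) ≤ ‖z‖ ^ m := one_le_pow₀ hge
    rw [hzm] at this
    exact (lt_irrefl _) (this.trans_lt hpinv1)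
  have hρz : ρ < ‖z‖ := lt_of_pow_lt_pow_left₀ m (norm_nonneg z) (by rw [hzm]; exact hρm)
  have hzd : (p : ℝ)⁻¹ < ‖z‖ ^ d := by
    rw [← hzm]; exact pow_lt_pow_right_of_lt_one₀ (norm_pos_iff.mpr hz0) hz1 hmd
  -- move off `F`
  obtain ⟨k, hkF, hk⟩ := exists_mul_one_add_pow_not_mem hF hz0
  refine ⟨z * (1 + (p : ℂ_[p]) ^ (k + 1)), hkF, ?_, ?_, ?_, ?_⟩
  · rw [hk]; exact hz1
  · rw [hk]; exact norm_pos_iff.mpr hz0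
  · intro α hα; rw [hk]; exact (hρT α hα).trans_lt hρz
  · rw [hk]; exact hzd

/-! ### §3 `g ∣ L` in `R₀⟦T⟧` ⟺ `‖L(x)‖ ≤ ‖g(x)‖` on the open disc -/

/-- **Sharp domination ⟹ exact divisibility.** For `g ≠ 0`, `L` in `Λ^ur = R₀⟦T⟧`: if `‖L(x)‖ ≤ ‖g(x)‖`
at every point of the open unit disc of `ℂ_p` outside a finite set `F`, then `L ∈ (g)`. (First
`p^μ L = q g` by `…UnrSeriesDomination`; if the `p`-content `b` of `q` were `< μ`, then at a point `x`
beyond the roots of the distinguished parts of `q` and `g` with `‖x‖^{deg P_q} > p⁻¹` one would have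
`‖L(x)‖ = p^{μ−b} ‖x‖^{deg P_q} ‖g(x)‖ > ‖g(x)‖ > 0`.) [cite: Washington1997, §7.1 Prop. 7.2, Thm. 7.3] -/
theorem mem_span_of_norm_value_le {g L : UnrSeries p} (hg : g ≠ 0) {F : Set ℂ_[p]} (hF : F.Finite)
    (hdom : ∀ x : ℂ_[p], x ∉ F → ‖x‖ < 1 → ∀ u v : ℂ_[p], g.HasValueAt x u → L.HasValueAt x v →
      ‖v‖ ≤ ‖u‖) : L ∈ Ideal.span {g} := by
  haveI := isDiscreteValuationRing_unrIntegers (p := p)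
  haveI : IsAdicComplete (IsLocalRing.maximalIdeal (unrIntegers p)) (unrIntegers p) :=
    isAdicComplete_maximalIdeal
  have hpR : (1 : ℝ) < p := by exact_mod_cast hp.out.one_lt
  have hp0 : (0 : ℝ) < p := by positivity
  -- step 0: divisibility up to `p^μ`
  obtain ⟨μ, hμ⟩ := exists_C_pow_mul_mem_span_of_norm_value_le_of_finite hg hF (C := 1)
    (fun x hxF hx u v hu hv ↦ by rw [one_mul]; exact hdom x hxF hx u v hu hv)
  obtain ⟨q, hq⟩ := Ideal.mem_span_singleton'.mp hμ
  have hCμ : (PowerSeries.C (((p : ℕ) : unrIntegers p) ^ μ) : UnrSeries p) ≠ 0 := by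
    intro h0
    have := congrArg PowerSeries.constantCoeff h0
    rw [PowerSeries.constantCoeff_C, map_zero] at this
    exact pow_ne_zero μ (irreducible_natCast_p (p := p)).ne_zero this
  by_cases hq0 : q = 0
  · -- then `L = 0`
    rw [hq0, zero_mul] at hq
    have hL : L = 0 := by
      rcases mul_eq_zero.mp hq.symm with h | h
      · exact absurd h hCμ
      · exact h
    rw [hL]; exact Ideal.zero_mem _
  -- `p`-content and Weierstrass data of `q` and `g`
  obtain ⟨b, q₀, hqb, hq₀⟩ := UnrSeries.exists_eq_C_pow_mul_map_residue_ne_zero hq0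
  obtain ⟨Pq, Uq, Hq⟩ := q₀.exists_isWeierstrassFactorization hq₀
  by_cases hbμ : μ ≤ b
  · -- cancel `p^μ`
    obtain ⟨c, rfl⟩ := Nat.exists_eq_add_of_le hbμ
    refine Ideal.mem_span_singleton'.mpr ⟨PowerSeries.C (((p : ℕ) : unrIntegers p) ^ c) * q₀, ?_⟩
    apply mul_left_cancel₀ hCμ
    rw [← hq, hqb, pow_add, map_mul]
    ring
  rw [not_le] at hbμ
  exfalso
  obtain ⟨a, g₀, hga, hg₀⟩ := UnrSeries.exists_eq_C_pow_mul_map_residue_ne_zero hg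
  obtain ⟨Pg, Ug, Hg⟩ := g₀.exists_isWeierstrassFactorization hg₀
  -- images in `ℂ_p[T]`, roots in the disc
  set Pqc : Polynomial ℂ_[p] := Pq.map (unrIntegers p).subtype with hPqc
  set Pgc : Polynomial ℂ_[p] := Pg.map (unrIntegers p).subtype with hPgc
  have hinj : Function.Injective (unrIntegers p).subtype := Subtype.coe_injective
  have hPqmo : Pqc.Monic := Hq.isDistinguishedAt.monic.map _
  have hPgmo : Pgc.Monic := Hg.isDistinguishedAt.monic.map _
  have hroot_lt : ∀ {P : Polynomial (unrIntegers p)},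
      P.IsDistinguishedAt (IsLocalRing.maximalIdeal (unrIntegers p)) →
      ∀ α ∈ (P.map (unrIntegers p).subtype).roots, ‖α‖ < 1 := by
    intro P HP α hα
    have hmo : (P.map (unrIntegers p).subtype).Monic := HP.monic.map _
    have hdeg : (P.map (unrIntegers p).subtype).natDegree = P.natDegree :=
      Polynomial.natDegree_map_eq_of_injective hinj P
    refine norm_root_lt_one hmo (fun k hk ↦ ?_) ((Polynomial.mem_roots hmo.ne_zero).mp hα)
    rw [Polynomial.coeff_map, Subring.subtype_apply]
    exact norm_lt_one_of_mem_maximalIdeal (HP.mem (by rwa [hdeg] at hk))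
  -- the test point
  set T : Finset ℂ_[p] := Pqc.roots.toFinset ∪ Pgc.roots.toFinset with hT
  have hT1 : ∀ α ∈ T, ‖α‖ < 1 := by
    intro α hα
    rw [hT, Finset.mem_union, Multiset.mem_toFinset, Multiset.mem_toFinset] at hα
    rcases hα with h | h
    · exact hroot_lt Hq.isDistinguishedAt α h
    · exact hroot_lt Hg.isDistinguishedAt α h
  obtain ⟨x, hxF, hx1, hx0, hxT, hxd⟩ := exists_point_near_rim T hT1 hF Pqc.natDegree
  have hxq : ∀ α ∈ Pqc.roots, ‖α‖ < ‖x‖ := fun α hα ↦ hxT α (by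
    rw [hT, Finset.mem_union, Multiset.mem_toFinset]; exact Or.inl hα)
  have hxg : ∀ α ∈ Pgc.roots, ‖α‖ < ‖x‖ := fun α hα ↦ hxT α (by
    rw [hT, Finset.mem_union, Multiset.mem_toFinset, Multiset.mem_toFinset]; exact Or.inr hα)
  have hPqx : ‖Pqc.eval x‖ = ‖x‖ ^ Pqc.natDegree := norm_eval_eq_pow_natDegree hPqmo hxq
  have hPgx : ‖Pgc.eval x‖ = ‖x‖ ^ Pgc.natDegree := norm_eval_eq_pow_natDegree hPgmo hxg
  -- values at `x`
  obtain ⟨uq, huq⟩ := exists_hasValueAt Uq hx1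
  obtain ⟨ug, hug⟩ := exists_hasValueAt Ug hx1
  obtain ⟨v, hv⟩ := exists_hasValueAt L hx1
  have huq1 : ‖uq‖ = 1 := norm_value_eq_one_of_isUnit Hq.isUnit hx1 huq
  have hug1 : ‖ug‖ = 1 := norm_value_eq_one_of_isUnit Hg.isUnit hx1 hug
  have hqv : UnrSeries.HasValueAt q x
      (((((p : ℕ) : unrIntegers p) ^ b : unrIntegers p) : ℂ_[p]) * (Pqc.eval x * uq)) := by
    rw [hqb, Hq.eq_mul]
    exact hasValueAt_C_mul _ (hasValueAt_mul hx1 (hasValueAt_coe_polynomial Pq x) huq)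
  have hgv : UnrSeries.HasValueAt g x
      (((((p : ℕ) : unrIntegers p) ^ a : unrIntegers p) : ℂ_[p]) * (Pgc.eval x * ug)) := by
    rw [hga, Hg.eq_mul]
    exact hasValueAt_C_mul _ (hasValueAt_mul hx1 (hasValueAt_coe_polynomial Pg x) hug)
  have hlhs : UnrSeries.HasValueAt (q * g) x
      ((((((p : ℕ) : unrIntegers p) ^ b : unrIntegers p) : ℂ_[p]) * (Pqc.eval x * uq)) *
        (((((p : ℕ) : unrIntegers p) ^ a : unrIntegers p) : ℂ_[p]) * (Pgc.eval x * ug))) :=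
    hasValueAt_mul hx1 hqv hgv
  have hrhs : UnrSeries.HasValueAt (PowerSeries.C (((p : ℕ) : unrIntegers p) ^ μ) * L) x
      (((((p : ℕ) : unrIntegers p) ^ μ : unrIntegers p) : ℂ_[p]) * v) := hasValueAt_C_mul _ hv
  rw [hq] at hlhs
  have heq := hrhs.unique hlhs
  -- norms: `p^{-μ} ‖v‖ = p^{-b} ‖x‖^{deg Pq} · ‖g(x)‖`
  have hng : ‖((((p : ℕ) : unrIntegers p) ^ a : unrIntegers p) : ℂ_[p]) * (Pgc.eval x * ug)‖ =
      ((p : ℝ)⁻¹) ^ a * ‖x‖ ^ Pgc.natDegree := by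
    rw [norm_mul, norm_mul, norm_coe_natCast_pow, hPgx, hug1, mul_one]
  have hgpos : 0 < ((p : ℝ)⁻¹) ^ a * ‖x‖ ^ Pgc.natDegree := by positivity
  have hdomx := hdom x hxF hx1 _ _ hgv hv
  rw [hng] at hdomx
  have hnormeq : ((p : ℝ)⁻¹) ^ μ * ‖v‖ =
      ((p : ℝ)⁻¹) ^ b * ‖x‖ ^ Pqc.natDegree * (((p : ℝ)⁻¹) ^ a * ‖x‖ ^ Pgc.natDegree) := by
    have := congrArg (fun t : ℂ_[p] ↦ ‖t‖) heq
    simp only [norm_mul, norm_coe_natCast_pow, hPqx, hPgx, huq1, hug1, mul_one] at this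
    rw [this]
  -- `‖v‖ ≤ ‖g(x)‖` contradicts `b < μ` and `‖x‖^{deg Pq} > p⁻¹`
  have h1 : ((p : ℝ)⁻¹) ^ μ * ‖v‖ ≤ ((p : ℝ)⁻¹) ^ μ * (((p : ℝ)⁻¹) ^ a * ‖x‖ ^ Pgc.natDegree) :=
    mul_le_mul_of_nonneg_left hdomx (by positivity)
  rw [hnormeq] at h1
  have h2 : ((p : ℝ)⁻¹) ^ b * ‖x‖ ^ Pqc.natDegree ≤ ((p : ℝ)⁻¹) ^ μ :=
    le_of_mul_le_mul_right (by linarith [h1]) hgpos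
  -- but `p^{-b} ‖x‖^{deg} > p^{-b} p^{-1} = p^{-(b+1)} ≥ p^{-μ}`
  have h3 : ((p : ℝ)⁻¹) ^ μ ≤ ((p : ℝ)⁻¹) ^ (b + 1) :=
    pow_le_pow_of_le_one (by positivity) (inv_lt_one_of_one_lt₀ hpR).le (by omega)
  have h4 : ((p : ℝ)⁻¹) ^ (b + 1) < ((p : ℝ)⁻¹) ^ b * ‖x‖ ^ Pqc.natDegree := by
    rw [pow_succ]
    exact mul_lt_mul_of_pos_left hxd (by positivity)
  linarith

/-- **The converse**: `L ∈ (g) ⟹ ‖L(x)‖ ≤ ‖g(x)‖` on the open disc (`‖q(x)‖ ≤ 1`).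
[cite: Washington1997, §7.1] -/
theorem norm_value_le_of_mem_span {g L : UnrSeries p} (h : L ∈ Ideal.span {g}) {x u v : ℂ_[p]}
    (hx : ‖x‖ < 1) (hu : g.HasValueAt x u) (hv : L.HasValueAt x v) : ‖v‖ ≤ ‖u‖ := by
  obtain ⟨q, hq⟩ := Ideal.mem_span_singleton'.mp h
  obtain ⟨w, hw⟩ := exists_hasValueAt q hx
  have h1 : UnrSeries.HasValueAt (q * g) x (w * u) := hasValueAt_mul hx hw hu
  rw [hq] at h1
  rw [hv.unique h1, norm_mul]
  exact mul_le_of_le_one_left (norm_nonneg _) (norm_value_le_one hx hw)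

/-- **`g ∣ L` in `Λ^ur = R₀⟦T⟧` ⟺ `‖L(x)‖ ≤ ‖g(x)‖` at every point of the open unit disc of `ℂ_p`**
(`g ≠ 0`): the values currency of the `μ`-free divisibility concluded by crux K1 (with `g` a generator
of `(Ch_Λ X_{∅,0}).map toUnr`). Compare `…UnrSeriesDomination.exists_C_pow_mul_mem_span_iff_norm_value_le`
(any uniform constant ⟺ divisibility up to `p^μ`, stub A). [cite: Washington1997, §7.1 Thm. 7.3] -/
theorem mem_span_iff_norm_value_le {g L : UnrSeries p} (hg : g ≠ 0) :
    L ∈ Ideal.span {g} ↔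
      ∀ x : ℂ_[p], ‖x‖ < 1 → ∀ u v : ℂ_[p], g.HasValueAt x u → L.HasValueAt x v → ‖v‖ ≤ ‖u‖ :=
  ⟨fun h _ hx _ _ hu hv ↦ norm_value_le_of_mem_span h hx hu hv,
    fun h ↦ mem_span_of_norm_value_le hg Set.finite_empty fun x _ hx u v hu hv ↦ h x hx u v hu hv⟩

/-- Ideal form: `span{L} ≤ span{g}` iff sharp domination on the disc. [cite: Washington1997, §7.1 Thm. 7.3] -/
theorem span_le_span_iff_norm_value_le {g L : UnrSeries p} (hg : g ≠ 0) :
    Ideal.span {L} ≤ Ideal.span {g} ↔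
      ∀ x : ℂ_[p], ‖x‖ < 1 → ∀ u v : ℂ_[p], g.HasValueAt x u → L.HasValueAt x v → ‖v‖ ≤ ‖u‖ := by
  rw [Ideal.span_singleton_le_iff_mem]
  exact mem_span_iff_norm_value_le hg

/-! ### §4 Equality of ideals ⟺ equality of absolute values on the disc -/

/-- **`(L) = (g)` in `Λ^ur = R₀⟦T⟧` ⟺ `‖L(x)‖ = ‖g(x)‖` at every point of the open unit disc of `ℂ_p`**
(`g, L ≠ 0`): the values currency of the full main-conjecture EQUALITY (K1's inclusion together with its
reverse), from `span_le_span_iff_norm_value_le` in both directions. [cite: Washington1997, §7.1 Thm. 7.3] -/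
theorem span_eq_span_iff_norm_value_eq {g L : UnrSeries p} (hg : g ≠ 0) (hL : L ≠ 0) :
    Ideal.span {L} = Ideal.span {g} ↔
      ∀ x : ℂ_[p], ‖x‖ < 1 → ∀ u v : ℂ_[p], g.HasValueAt x u → L.HasValueAt x v → ‖v‖ = ‖u‖ := by
  constructor
  · intro h x hx u v hu hv
    exact le_antisymm ((span_le_span_iff_norm_value_le hg).mp h.le x hx u v hu hv)
      ((span_le_span_iff_norm_value_le hL).mp h.ge x hx v u hv hu)
  · intro h
    exact le_antisymm
      ((span_le_span_iff_norm_value_le hg).mpr fun x hx u v hu hv ↦ (h x hx u v hu hv).le)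
      ((span_le_span_iff_norm_value_le hL).mpr fun x hx u v hu hv ↦ (h x hx v u hv hu).ge)

/-- The same for elements: `L` and `g` are ASSOCIATED in `R₀⟦T⟧` (differ by a unit) iff
`‖L(x)‖ = ‖g(x)‖` on the open disc. [cite: Washington1997, §7.1 Thm. 7.3] -/
theorem associated_iff_norm_value_eq {g L : UnrSeries p} (hg : g ≠ 0) (hL : L ≠ 0) :
    Associated L g ↔
      ∀ x : ℂ_[p], ‖x‖ < 1 → ∀ u v : ℂ_[p], g.HasValueAt x u → L.HasValueAt x v → ‖v‖ = ‖u‖ := by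
  rw [← Ideal.span_singleton_eq_span_singleton]
  exact span_eq_span_iff_norm_value_eq hg hL

end Summit.BirchSwinnertonDyer.BirchSwinnertonDyer.Theorems.CumulativeHeegnerInclusionAtThreeUnrSeriesDominationSharp

end
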